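import Mathlib
import Summits.ValiantsHypothesis.ValiantsHypothesis.Theorems.ProofCarryingSymmetryRestorationQPACCircuit

/-!
# Route ProofCarryingSymmetry — crux `RestorationQP`, line `registered`, stub S3 (`stub_stabilityAtACBudget`), part 6:
semantics and size of the AC-canonical circuit; the stub

Continuation of `…RestorationQPACCircuit.lean` (`ACStability.acCircuit t L hL`).  Over a commutative
semiring of constants:

* every gate computes what it should (`eval_acCircuit`): `leaf q`, `node q` compute `q̂`
  (`ACClass.eval`), the chain element `pw (q,k) i` computes `2^i · k̂` under a `+`-parent and
  `k̂^(2^i)` under a `×`-parent — so the children of `node q`, indexed by the binary digits of the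
  multiplicities, add up to `Σ_k (count k) · k̂ = q̂` (resp. multiply to `Π_k k̂^(count k) = q̂`);
  in particular the output computes `t̂`, i.e. `Ĉ` for `t = topClass C`;
* the gate count is `|leafSet| + |nodeSet| + 2L|pairSet| ≤ 2(|C|+1) + 2(|C|+1)^3 ≤ (|C|+n+2)^4`
  for `t = topClass C`, `L = |C| + 1` (parts 3–4: `≤ |C| + 1` reachable classes);
* **`stub_stabilityAtACBudget`** — the registered stub S3 of the line: AC-provable invariance
  (`P_c(ℂ)` proofs of all `C ∘ σ = C` without A6–A10) ⇒ an `S_n`-symmetric labelled circuit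
  computing `Ĉ` of size `≤ (|C| + n + 2)^4`.

Everything proved; no named facts.  (DW = Dawar–Wilsenach ToC 2025, Defs. 2.2, 3.6, 3.7;
HT = Hrubeš–Tzameret arXiv:1112.6265 §1.1.)
-/

-- single-problem summit: `Summit.ValiantsHypothesis.ValiantsHypothesis.…` is the namespace by design (D-0017)
set_option linter.dupNamespace false

noncomputable section

open scoped Classical

namespace Summit.ValiantsHypothesis.ValiantsHypothesis.Theorems

namespace ACStability

open Literature.Computability.AlgebraicComplexity ACClass ACGate

universe u v

variable {𝔽 : Type u} {X : Type v} {t : ACClass 𝔽 X} {L : ℕ}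

/-! ### The intended values of the gates -/

section Values

variable [CommSemiring 𝔽]

/-- The value of the `i`-th element of a doubling chain on `v` under a parent labelled `lbl`:
`v^(2^i)` under `×`, `2^i · v` otherwise. [folklore] -/
def chainVal (lbl : CircuitLabel 𝔽 X) (i : ℕ) (v : MvPolynomial X 𝔽) : MvPolynomial X 𝔽 :=
  if lbl = .mul then v ^ (2 ^ i) else (2 ^ i : ℕ) • v

/-- `chainVal` at `0` is the identity. [folklore] -/
theorem chainVal_zero (lbl : CircuitLabel 𝔽 X) (v : MvPolynomial X 𝔽) : chainVal lbl 0 v = v := by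
  unfold chainVal; split <;> simp

/-- Doubling under `+`. [folklore] -/
theorem chainVal_succ_add (i : ℕ) (v : MvPolynomial X 𝔽) :
    chainVal .add (i + 1) v = chainVal .add i v + chainVal (.add : CircuitLabel 𝔽 X) i v := by
  simp only [chainVal, reduceCtorEq, ↓reduceIte, ← add_nsmul]
  congr 1; ring

/-- Squaring under `×`. [folklore] -/
theorem chainVal_succ_mul (i : ℕ) (v : MvPolynomial X 𝔽) :
    chainVal .mul (i + 1) v = chainVal .mul i v * chainVal (.mul : CircuitLabel 𝔽 X) i v := by
  simp only [chainVal, ↓reduceIte, ← pow_add]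
  congr 1; ring

/-- The intended value of every gate. [folklore] -/
def gVal : ACGate t L → MvPolynomial X 𝔽
  | leaf q => q.1.eval
  | node q => q.1.eval
  | pw p i => chainVal p.1.1.label i.1 p.1.2.eval
  | cp p i => chainVal p.1.1.label i.1 p.1.2.eval

/-- The gate of a class is meant to compute the class. [folklore] -/
theorem gVal_gateOf (k : ACClass 𝔽 X) (hk : k ∈ reach t) : gVal (gateOf t L k hk) = k.eval := by
  unfold gateOf; split <;> rfl

end Values

/-! ### The children, explicitly -/

section Children

variable (hL : ∀ q ∈ reach t, Multiset.card q.kids < 2 ^ L)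

/-- Children of a copy gate. [folklore] -/
theorem children_cp (p : {p // p ∈ pairSet t}) (i : Fin L) :
    (acCircuit t L hL).children (cp p i) = {pw p i} := by
  ext h; simp [mem_children_acCircuit, IsChild]

/-- Children of the bottom of a chain. [folklore] -/
theorem children_pw_zero (p : {p // p ∈ pairSet t}) (i : Fin L) (hi : i.1 = 0) :
    (acCircuit t L hL).children (pw p i) = {gateOf t L p.1.2 (snd_mem_reach p)} := by
  ext h
  simp only [mem_children_acCircuit, IsChild, Finset.mem_singleton]
  constructor
  · rintro (⟨-, rfl⟩ | ⟨j, hj, _⟩)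
    · rfl
    · omega
  · rintro rfl; exact Or.inl ⟨hi, rfl⟩

/-- Children higher up a chain. [folklore] -/
theorem children_pw_succ (p : {p // p ∈ pairSet t}) (i j : Fin L) (hj : j.1 + 1 = i.1) :
    (acCircuit t L hL).children (pw p i) = {pw p j, cp p j} := by
  ext h
  simp only [mem_children_acCircuit, IsChild, Finset.mem_insert, Finset.mem_singleton]
  constructor
  · rintro (⟨hi, rfl⟩ | ⟨j', hj', h⟩)
    · omega
    · have : j' = j := Fin.ext (by omega)
      subst this; exact h
  · intro h; exact Or.inr ⟨j, hj, h⟩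

/-- The index set of the children of a node: pairs (child class, binary digit of its multiplicity).
[folklore] -/
def nodeKidIdx (L : ℕ) (q : {q // q ∈ nodeSet t}) : Finset (ACClass 𝔽 X × ℕ) :=
  (q.1.kids.toFinset ×ˢ Finset.range L).filter fun ki => ki.2 ∈ (q.1.kids.count ki.1).bitIndices

/-- The child gate with a given index (junk: the node itself). [folklore] -/
def nodeKidGate (q : {q // q ∈ nodeSet t}) (ki : ACClass 𝔽 X × ℕ) : ACGate t L :=
  if h : ki.1 ∈ q.1.kids ∧ ki.2 < L then
    pw (mkPair q.1 ki.1 (mem_nodeSet.1 q.2).1 (mem_nodeSet.1 q.2).2 h.1) ⟨ki.2, h.2⟩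
  else node q

/-- Membership in the index set. [folklore] -/
theorem mem_nodeKidIdx {q : {q // q ∈ nodeSet t}} {ki : ACClass 𝔽 X × ℕ} :
    ki ∈ nodeKidIdx L q ↔ ki.1 ∈ q.1.kids ∧ ki.2 < L ∧ ki.2 ∈ (q.1.kids.count ki.1).bitIndices := by
  simp [nodeKidIdx, and_assoc]

/-- The children of a node are the indexed child gates. [folklore] -/
theorem children_node (q : {q // q ∈ nodeSet t}) :
    (acCircuit t L hL).children (node q) = (nodeKidIdx L q).image (nodeKidGate q) := by
  ext h
  simp only [mem_children_acCircuit, IsChild, Finset.mem_image]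
  constructor
  · rintro ⟨p, i, rfl, hpq, hi⟩
    have hk : p.1.2 ∈ q.1.kids := hpq ▸ snd_mem_kids p
    refine ⟨(p.1.2, i.1), mem_nodeKidIdx.2 ⟨hk, i.2, hi⟩, ?_⟩
    simp only [nodeKidGate, hk, i.2, and_self, ↓reduceDIte]
    congr 1
    exact Subtype.ext (Prod.ext hpq.symm rfl)
  · rintro ⟨ki, hki, rfl⟩
    obtain ⟨hk, hi, hb⟩ := mem_nodeKidIdx.1 hki
    refine ⟨mkPair q.1 ki.1 (mem_nodeSet.1 q.2).1 (mem_nodeSet.1 q.2).2 hk, ⟨ki.2, hi⟩, ?_, rfl, hb⟩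
    simp [nodeKidGate, hk, hi]

/-- The indexing of the children of a node is injective. [folklore] -/
theorem nodeKidGate_injOn (q : {q // q ∈ nodeSet t}) :
    Set.InjOn (nodeKidGate (L := L) q) (nodeKidIdx L q) := by
  intro a ha b hb hab
  obtain ⟨ha1, ha2, -⟩ := mem_nodeKidIdx.1 (Finset.mem_coe.1 ha)
  obtain ⟨hb1, hb2, -⟩ := mem_nodeKidIdx.1 (Finset.mem_coe.1 hb)
  simp only [nodeKidGate, ha1, ha2, and_self, ↓reduceDIte, hb1, hb2, pw.injEq] at hab
  obtain ⟨h1, h2⟩ := hab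
  have h1' : a.1 = b.1 := congrArg (fun p : {p // p ∈ pairSet t} => p.1.2) h1
  have h2' : a.2 = b.2 := congrArg Fin.val h2
  exact Prod.ext h1' h2'

include hL in
/-- All binary digits of a multiplicity of a reachable class are `< L`. [folklore] -/
theorem filter_range_eq_bitIndices {q : ACClass 𝔽 X} (hq : q ∈ reach t) (k : ACClass 𝔽 X) :
    (Finset.range L).filter (fun i => i ∈ (q.kids.count k).bitIndices) = (q.kids.count k).bitIndices.toFinset := by
  ext i
  simp only [Finset.mem_filter, Finset.mem_range, List.mem_toFinset, and_iff_right_iff_imp]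
  exact fun hi => lt_of_mem_bitIndices_count hL hq hi

/-- The label of a gate of the AC-canonical circuit. [folklore] -/
theorem label_acCircuit (g : ACGate t L) : (acCircuit t L hL).label g = gLabel t L g := rfl

end Children

/-! ### Every gate computes its intended value -/

section Eval

variable [CommSemiring 𝔽] (hL : ∀ q ∈ reach t, Multiset.card q.kids < 2 ^ L)

/-- The intended value of an indexed child gate. [folklore] -/
theorem gVal_nodeKidGate {q : {q // q ∈ nodeSet t}} {ki : ACClass 𝔽 X × ℕ} (h : ki ∈ nodeKidIdx L q) :
    gVal (nodeKidGate (L := L) q ki) = chainVal q.1.label ki.2 ki.1.eval := by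
  obtain ⟨hk, hi, -⟩ := mem_nodeKidIdx.1 h
  simp [nodeKidGate, hk, hi, gVal, mkPair]

/-- Binary expansion, additive form: `Σ_{digits i} 2^i · v = m · v`. [folklore] -/
theorem sum_bitIndices_chainVal_add (m : ℕ) (v : MvPolynomial X 𝔽) :
    ∑ i ∈ m.bitIndices.toFinset, chainVal (.add : CircuitLabel 𝔽 X) i v = m • v := by
  simp only [chainVal, reduceCtorEq, ↓reduceIte]
  rw [← Finset.sum_smul, List.sum_toFinset _ Nat.bitIndices_nodup]
  -- ⊢ (List.map (fun i => 2 ^ i) m.bitIndices).sum • v = m • v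
  rw [Nat.sum_map_two_pow_bitIndices]

/-- Binary expansion, multiplicative form: `Π_{digits i} v^(2^i) = v^m`. [folklore] -/
theorem prod_bitIndices_chainVal_mul (m : ℕ) (v : MvPolynomial X 𝔽) :
    ∏ i ∈ m.bitIndices.toFinset, chainVal (.mul : CircuitLabel 𝔽 X) i v = v ^ m := by
  simp only [chainVal, ↓reduceIte]
  rw [Finset.prod_pow_eq_pow_sum, List.sum_toFinset _ Nat.bitIndices_nodup, Nat.sum_map_two_pow_bitIndices]

/-- **The children of a `+`-node add up to the node's polynomial.** [folklore] -/
theorem sum_children_node_gVal {q : {q // q ∈ nodeSet t}} (hadd : q.1.label = .add) :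
    ∑ h ∈ (acCircuit t L hL).children (node q), gVal h = q.1.eval := by
  have hq : q.1 ∈ reach t := (mem_nodeSet.1 q.2).1
  rw [children_node, Finset.sum_image (nodeKidGate_injOn q)]
  rw [Finset.sum_congr rfl fun ki hki => gVal_nodeKidGate (L := L) hki]
  rw [nodeKidIdx, Finset.sum_filter, Finset.sum_product]
  simp only [hadd]
  rw [eval_eq_sum_of_label_add hadd, Finset.sum_multiset_map_count]
  refine Finset.sum_congr rfl fun k _ => ?_
  rw [← Finset.sum_filter, filter_range_eq_bitIndices hL hq k, sum_bitIndices_chainVal_add]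

/-- **The children of a `×`-node multiply to the node's polynomial.** [folklore] -/
theorem prod_children_node_gVal {q : {q // q ∈ nodeSet t}} (hmul : q.1.label = .mul) :
    ∏ h ∈ (acCircuit t L hL).children (node q), gVal h = q.1.eval := by
  have hq : q.1 ∈ reach t := (mem_nodeSet.1 q.2).1
  rw [children_node, Finset.prod_image (nodeKidGate_injOn q)]
  rw [Finset.prod_congr rfl fun ki hki => gVal_nodeKidGate (L := L) hki]
  rw [nodeKidIdx, Finset.prod_filter, Finset.prod_product]
  simp only [hmul]
  rw [eval_eq_prod_of_label_mul hmul, Finset.prod_multiset_map_count]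
  refine Finset.prod_congr rfl fun k _ => ?_
  rw [← Finset.prod_filter, filter_range_eq_bitIndices hL hq k, prod_bitIndices_chainVal_mul]

/-- **Semantics of the AC-canonical circuit**: every gate computes its intended value.
[folklore] -/
theorem eval_acCircuit : ∀ g, (acCircuit t L hL).eval g = gVal g := by
  intro g
  induction g using (acCircuit t L hL).wf.induction with
  | h g ih =>
    cases g with
    | leaf q =>
      have hin := (mem_leafSet.1 q.2).2
      rcases hq : q.1.label with x | c | _ | _
      · rw [(acCircuit t L hL).eval_of_label_var (g := leaf q) (by rw [label_acCircuit, gLabel, hq])]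
        exact (eval_of_label_var hq).symm
      · rw [(acCircuit t L hL).eval_of_label_const (g := leaf q) (by rw [label_acCircuit, gLabel, hq])]
        exact (eval_of_label_const hq).symm
      · simp [hq, CircuitLabel.IsInput] at hin
      · simp [hq, CircuitLabel.IsInput] at hin
    | node q =>
      have hnin := (mem_nodeSet.1 q.2).2
      have ih' : ∀ h ∈ (acCircuit t L hL).children (node q), (acCircuit t L hL).eval h = gVal h :=
        fun h hh => ih h hh
      rcases hq : q.1.label with x | c | _ | _
      · simp [hq, CircuitLabel.IsInput] at hnin
      · simp [hq, CircuitLabel.IsInput] at hnin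
      · rw [(acCircuit t L hL).eval_of_label_add (g := node q) (by rw [label_acCircuit, gLabel, hq]),
          Finset.sum_congr rfl ih', sum_children_node_gVal hL hq]
        rfl
      · rw [(acCircuit t L hL).eval_of_label_mul (g := node q) (by rw [label_acCircuit, gLabel, hq]),
          Finset.prod_congr rfl ih', prod_children_node_gVal hL hq]
        rfl
    | pw p i =>
      have hnin := not_isInput_fst p
      have ih' : ∀ h ∈ (acCircuit t L hL).children (pw p i), (acCircuit t L hL).eval h = gVal h :=
        fun h hh => ih h hh
      show _ = chainVal p.1.1.label i.1 p.1.2.eval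
      rcases Nat.eq_zero_or_pos i.1 with hi | hi
      · -- bottom of the chain: a fan-in-one copy of the gate of the child class
        have hch := children_pw_zero hL p i hi
        have hval : (acCircuit t L hL).eval (gateOf t L p.1.2 (snd_mem_reach p)) = p.1.2.eval := by
          rw [ih' _ (by rw [hch]; exact Finset.mem_singleton_self _), gVal_gateOf]
        rw [hi, chainVal_zero]
        rcases hq : p.1.1.label with x | c | _ | _
        · simp [hq, CircuitLabel.IsInput] at hnin
        · simp [hq, CircuitLabel.IsInput] at hnin
        · rw [(acCircuit t L hL).eval_of_label_add (g := pw p i) (by rw [label_acCircuit, gLabel, hq]), hch,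
            Finset.sum_singleton, hval]
        · rw [(acCircuit t L hL).eval_of_label_mul (g := pw p i) (by rw [label_acCircuit, gLabel, hq]), hch,
            Finset.prod_singleton, hval]
      · -- higher up: children `pw p j`, `cp p j` with `j + 1 = i`
        set j : Fin L := ⟨i.1 - 1, by omega⟩ with hj
        have hji : j.1 + 1 = i.1 := by simp [hj]; omega
        have hch := children_pw_succ hL p i j hji
        have hne : pw p j ≠ cp p j := by simp
        have h1 : (acCircuit t L hL).eval (pw p j) = chainVal p.1.1.label j.1 p.1.2.eval :=
          ih' _ (by rw [hch]; simp)
        have h2 : (acCircuit t L hL).eval (cp p j) = chainVal p.1.1.label j.1 p.1.2.eval :=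
          ih' _ (by rw [hch]; simp)
        rw [← hji]
        rcases hq : p.1.1.label with x | c | _ | _
        · simp [hq, CircuitLabel.IsInput] at hnin
        · simp [hq, CircuitLabel.IsInput] at hnin
        · rw [(acCircuit t L hL).eval_of_label_add (g := pw p i) (by rw [label_acCircuit, gLabel, hq]), hch,
            Finset.sum_pair hne, h1, h2, hq, chainVal_succ_add]
        · rw [(acCircuit t L hL).eval_of_label_mul (g := pw p i) (by rw [label_acCircuit, gLabel, hq]), hch,
            Finset.prod_pair hne, h1, h2, hq, chainVal_succ_mul]
    | cp p i =>
      rw [(acCircuit t L hL).eval_of_label_add (g := cp p i) rfl, children_cp, Finset.sum_singleton,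
        ih _ (by simp [mem_children_acCircuit, IsChild])]
      rfl

/-- **The output of the AC-canonical circuit computes `t̂`.** [folklore] -/
theorem eval_output_acCircuit : (acCircuit t L hL).eval ((acCircuit t L hL).output ()) = t.eval := by
  change (acCircuit t L hL).eval (gateOf t L t (self_mem_reach t)) = t.eval
  rw [eval_acCircuit, gVal_gateOf]

/-! ### Size -/

omit [CommSemiring 𝔽] in
/-- **Gate count**: `≤ 2·r + 2·L·r²` for `r` reachable classes. [folklore] -/
theorem card_acGate_le (r : ℕ) (hr : (reach t).card ≤ r) :
    Fintype.card (ACGate t L) ≤ 2 * r + 2 * L * r ^ 2 := by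
  rw [ACGate.card_eq]
  have h1 : (leafSet t).card ≤ r := (Finset.card_filter_le _ _).trans hr
  have h2 : (nodeSet t).card ≤ r := (Finset.card_filter_le _ _).trans hr
  have h3 : (pairSet t).card ≤ r ^ 2 := by
    calc (pairSet t).card ≤ ((reach t) ×ˢ (reach t)).card := Finset.card_filter_le _ _
      _ = (reach t).card * (reach t).card := Finset.card_product _ _
      _ ≤ r * r := Nat.mul_le_mul hr hr
      _ = r ^ 2 := (sq r).symm
  have h4 : (pairSet t).card * L ≤ r ^ 2 * L := Nat.mul_le_mul_right _ h3
  nlinarith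

end Eval

end ACStability

open Literature.Computability.AlgebraicComplexity in
/-- **Stub S3 — stability at distributivity budget zero** (registered stub of the line `registered`
of crux `RestorationQP`, item stmt-ValiantsHypothesis-10343; "zero proof length = syntactic
symmetry"): if every invariance identity `C ∘ σ = C`, `σ ∈ S_n`, of a Hrubeš–Tzameret circuit `C`
over `ℂ` in the matrix variables has a `P_c(ℂ)`-proof using only A1–A5, C1, C2 (no instance of
A6–A10), then the AC-canonical circuit of `C` is an `S_n`-symmetric labelled arithmetic circuit
(Dawar–Wilsenach Def. 3.7) computing `Ĉ`, of size `≤ (|C| + n + 2)^4`. [folklore] -/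
theorem stub_stabilityAtACBudget : ∃ c : ℕ, ∀ (n : ℕ) (C : PICircuit ℂ (Fin n × Fin n)), (∀ σ : Equiv.Perm (Fin n), HasPCProof (C.rename fun x : Fin n × Fin n => σ • x) C (fun s => if s = PIAxiom.A6 ∨ s = PIAxiom.A7 ∨ s = PIAxiom.A8 ∨ s = PIAxiom.A9 ∨ s = PIAxiom.A10 then 0 else ⊤)) → ∃ (G : Type) (_ : Fintype G) (D : LabelledArithCircuit ℂ (Fin n × Fin n) Unit G), D.IsSymmetric (Equiv.Perm (Fin n)) ∧ D.eval (D.output ()) = C.eval ∧ Fintype.card G ≤ (C.size + n + 2) ^ c := by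
  refine ⟨4, fun n C h => ?_⟩
  have hL : ∀ q ∈ ACStability.ACClass.reach (ACStability.topClass C), Multiset.card q.kids < 2 ^ (C.size + 1) :=
    fun _ hq => ACStability.card_kids_lt_of_mem_reach hq
  refine ⟨ACStability.ACGate (ACStability.topClass C) (C.size + 1), inferInstance,
    ACStability.acCircuit (ACStability.topClass C) (C.size + 1) hL,
    ACStability.isSymmetric_acCircuit hL (stabilityAtACBudget_aux_topClass n C h),
    ACStability.eval_output_acCircuit hL, ?_⟩
  have hcard := ACStability.card_acGate_le (t := ACStability.topClass C) (L := C.size + 1) (C.size + 1)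
    (ACStability.card_reach_topClass_le C)
  refine hcard.trans ?_
  have hs : 1 ≤ C.size := C.one_le_size
  set a : ℕ := C.size + 1 with ha
  have h1 : 2 * a + 2 * a * a ^ 2 ≤ (a + 1) ^ 4 := by nlinarith
  calc 2 * a + 2 * a * a ^ 2 ≤ (a + 1) ^ 4 := h1
    _ ≤ (C.size + n + 2) ^ 4 := Nat.pow_le_pow_left (by omega) 4

end Summit.ValiantsHypothesis.ValiantsHypothesis.Theorems

end
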